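import Literature.AlgebraicTopology.Homotopy.HopfFibration
import Literature.AlgebraicTopology.SingularHomology.HurewiczTheoremProofs
import Literature.AlgebraicTopology.SingularHomology.SphereHomology
import Literature.AlgebraicTopology.FundamentalGroup.SphereSimplyConnected
import Literature.AlgebraicTopology.Homotopy.HomotopyGroupsGeneralPosition
import Literature.AlgebraicTopology.Homotopy.FreudenthalSuspension
import Literature.AlgebraicTopology.FundamentalGroup.CircleAndTorus
import HarnessLib

/-!
# `π₃(S²) ≅ ℤ` (Hopf 1931) and `π₂(S²) ≅ ℤ`

Topic `Literature/AlgebraicTopology/Homotopy`. H. Hopf, *Über die Abbildungen der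
dreidimensionalen Sphäre auf die Kugelfläche*, Math. Ann. 104 (1931), 637–665 (the group of
homotopy classes of maps `S³ → S²` is infinite, detected by the Hopf invariant); in the modern
form A. Hatcher, *Algebraic Topology* (2002), Example 4.45 with Cor. 4.25: the Hopf bundle gives
`π₃(S²) ≅ π₃(S³)`, and `π₃(S³) ≅ ℤ` by the Hurewicz theorem (Thm. 4.32) and `H₃(S³) ≅ ℤ`
(Cor. 2.14). PROVED here from the tree's Hopf bundle (`HopfFibration.lean`), Hurewicz isomorphism
(`hurewicz_iso_of_collapseDevice`) and homology of spheres: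

* `nonempty_mulEquiv_pi_three_sphere_three_int` — `π₃(S³, x) ≃* ℤ` (multiplicatively written);
* **`nonempty_mulEquiv_pi_three_sphere_two_int`** — `π₃(S², y) ≃* ℤ` at every base point;
* **`nonempty_mulEquiv_pi_two_sphere_two_int`** — `π₂(S², y) ≃* ℤ` (Hatcher Example 4.45 / Cor.
  4.25: the connecting map `π₂(S²) → π₁(S¹)` of the Hopf bundle is an isomorphism since
  `π₂(S³) = π₁(S³) = 0`, and `π₁(S¹) ≅ ℤ`, Thm. 1.7).

Everything is proved; no named facts.

## References

* H. Hopf, *Über die Abbildungen der dreidimensionalen Sphäre auf die Kugelfläche*, Math. Ann.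
  104 (1931), 637–665.
* A. Hatcher, *Algebraic Topology*, CUP (2002), Example 4.45, Cor. 4.25, Thm. 4.32, Cor. 2.14.
  [HatcherAT2002]
-/

noncomputable section

open Set Function Metric Topology
open scoped Topology
open Literature.AlgebraicTopology.SingularHomology

namespace Literature.AlgebraicTopology.Homotopy

namespace HopfFibration

/-- Local notation: `𝔼 n` is `EuclideanSpace ℝ (Fin n)`. -/
local notation "𝔼 " n:arg => EuclideanSpace ℝ (Fin n)

/-- Local notation: `𝕊 n` is the unit sphere of `EuclideanSpace ℝ (Fin (n + 1))`. -/
local notation "𝕊 " n:arg => (Metric.sphere (0 : EuclideanSpace ℝ (Fin (n + 1))) 1)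

/-- **`π₃(S³, x) ≅ ℤ`** (Hurewicz, Hatcher Thm. 4.32 and Cor. 4.25, with `H₃(S³; ℤ) ≅ ℤ`,
Cor. 2.14; `S³` is simply connected with `π₂ = 0`). [cite: HatcherAT2002, Cor. 4.25, Thm. 4.32] -/
theorem nonempty_mulEquiv_pi_three_sphere_three_int (x : 𝕊 3) :
    Nonempty (π_ 3 (𝕊 3) x ≃* Multiplicative ℤ) := by
  haveI : SimplyConnectedSpace (𝕊 3) :=
    Literature.AlgebraicTopology.FundamentalGroup.simplyConnectedSpace_euclideanSphere 3 (by norm_num)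
  have hconn : ∀ k : ℕ, 2 ≤ k → k < 3 → ∀ y : 𝕊 3, Subsingleton (π_ k (𝕊 3) y) := fun k _ hk y =>
    subsingleton_homotopyGroup_sphere (by rw [finrank_euclideanSpace, Fintype.card_fin]; omega) y
  obtain ⟨e⟩ := hurewicz_iso_of_collapseDevice (𝕊 3) 3 (by norm_num) hconn x
  obtain ⟨e'⟩ := nonempty_singularHomology_sphere_iso_holds ℤ ℤ (n := 3) (by norm_num)
  exact ⟨e.trans (AddEquiv.toMultiplicative (e'.toLinearEquiv.toAddEquiv.trans AddEquiv.ulift))⟩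

/-- **`π₃(S²) ≅ ℤ`** (Hopf 1931; Hatcher Example 4.45: `η_* : π₃(S³) ≅ π₃(S²)` from the Hopf
bundle, and `π₃(S³) ≅ ℤ`), at every base point. [cite: HatcherAT2002, Example 4.45, Cor. 4.25] -/
theorem nonempty_mulEquiv_pi_three_sphere_two_int (y : 𝕊 2) :
    Nonempty (π_ 3 (𝕊 2) y ≃* Multiplicative ℤ) := by
  -- move the base point to `η x₀` for a point `x₀` of `S³` (spheres are homogeneous)
  let x₀ : 𝕊 3 := ⟨EuclideanSpace.single (0 : Fin 4) (1 : ℝ), by simp⟩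
  obtain ⟨eb⟩ := Freudenthal.nonempty_mulEquiv_of_basepoints (k := 3) (i := 2) y (hopf x₀)
  obtain ⟨e3⟩ := nonempty_mulEquiv_pi_three_sphere_three_int x₀
  -- `η_*` is a bijective homomorphism `π₃(S³, x₀) → π₃(S², η x₀)`
  let η : π_ 3 (𝕊 3) x₀ ≃* π_ 3 (𝕊 2) (hopf x₀) :=
    MulEquiv.ofBijective (homotopyGroupMapHom (N := Fin 3) hopf x₀)
      (bijective_homotopyGroupMap_hopf (N := Fin 3) (by simp) x₀)
  exact ⟨eb.trans (η.symm.trans e3)⟩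

/-- **`π₂(S²) ≅ ℤ`** (Hatcher Example 4.45 with Thm. 4.41 and Thm. 1.7: in the long exact
sequence of the Hopf bundle `π₂(S³) → π₂(S²) →∂ π₁(S¹) → π₁(S³)` the outer groups vanish), at
every base point. [cite: HatcherAT2002, Example 4.45, Cor. 4.25, Thm. 1.7 (p. 29)] -/
theorem nonempty_mulEquiv_pi_two_sphere_two_int (y : 𝕊 2) :
    Nonempty (π_ 2 (𝕊 2) y ≃* Multiplicative ℤ) := by
  let x₀ : 𝕊 3 := ⟨EuclideanSpace.single (0 : Fin 4) (1 : ℝ), by simp⟩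
  obtain ⟨eb⟩ := Freudenthal.nonempty_mulEquiv_of_basepoints (k := 3) (i := 1) y (hopf x₀)
  -- index bookkeeping: the face `{j : Fin 2 // j ≠ 0}` has one element
  haveI : Nonempty { j : Fin 2 // j ≠ (0 : Fin 2) } := ⟨⟨1, by decide⟩⟩
  haveI hU : Unique { j : Fin 2 // j ≠ (0 : Fin 2) } :=
    { default := ⟨1, by decide⟩
      uniq := fun j => Subtype.ext (Fin.eq_one_of_ne_zero j.1 j.2) }
  -- `π₂(S³) = 0` and `π₁(S³) = 0`
  have hS3_2 : Subsingleton (HomotopyGroup (Fin 2) (𝕊 3) x₀) :=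
    subsingleton_homotopyGroup_sphere (by rw [finrank_euclideanSpace, Fintype.card_fin]; omega) x₀
  haveI : SimplyConnectedSpace (𝕊 3) :=
    Literature.AlgebraicTopology.FundamentalGroup.simplyConnectedSpace_euclideanSphere 3 (by norm_num)
  have hS3_1 : Subsingleton (HomotopyGroup { j : Fin 2 // j ≠ (0 : Fin 2) } (𝕊 3) x₀) :=
    (homotopyGroupEquivFundamentalGroupOfUnique (X := 𝕊 3) (x := x₀) { j : Fin 2 // j ≠ (0 : Fin 2) }).subsingleton
  -- the connecting homomorphism `∂ : π₂(S², η x₀) → π₁(fibre, x₀)` is bijective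
  have hF := isSerreFibration_hopf
  have hinj : Function.Injective (IsSerreFibration.deltaHom hF (0 : Fin 2) x₀) := by
    refine (injective_iff_map_eq_one _).2 fun b hb => ?_
    have hb' : IsSerreFibration.delta hF (0 : Fin 2) x₀ b = ⟦GenLoop.const⟧ := by
      rw [← IsSerreFibration.coe_deltaHom, hb, HomotopyGroup.one_def]
    obtain ⟨c, rfl⟩ := IsSerreFibration.exists_proj_eq hF (0 : Fin 2) x₀ b hb'
    rw [Subsingleton.elim (h := hS3_2) c ⟦GenLoop.const⟧]
    exact congrArg (Quotient.mk _) (GenLoop.ext _ _ fun _ => rfl)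
  have hsurj : Function.Surjective (IsSerreFibration.deltaHom hF (0 : Fin 2) x₀) := fun c =>
    IsSerreFibration.exists_delta_eq hF (0 : Fin 2) x₀ c (Subsingleton.elim (h := hS3_1) _ _)
  let eδ : HomotopyGroup (Fin 2) (𝕊 2) (hopf x₀) ≃*
      HomotopyGroup { j : Fin 2 // j ≠ (0 : Fin 2) } ↥(fibre (⇑hopf) x₀) (fibreBase (⇑hopf) x₀) :=
    MulEquiv.ofBijective _ ⟨hinj, hsurj⟩
  -- the fibre is a circle, whose `π₁` is `ℤ`
  obtain ⟨φ⟩ := nonempty_fibre_homeomorph x₀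
  let e1 : HomotopyGroup { j : Fin 2 // j ≠ (0 : Fin 2) } ↥(fibre (⇑hopf) x₀) (fibreBase (⇑hopf) x₀) ≃*
      HomotopyGroup { j : Fin 2 // j ≠ (0 : Fin 2) } Circle (φ (fibreBase (⇑hopf) x₀)) :=
    homotopyGroupMulEquivOfHomeomorph φ (fibreBase (⇑hopf) x₀)
  let eIdx : { j : Fin 2 // j ≠ (0 : Fin 2) } ≃ Fin 1 := Equiv.ofUnique _ _
  let e2 : HomotopyGroup { j : Fin 2 // j ≠ (0 : Fin 2) } Circle (φ (fibreBase (⇑hopf) x₀)) ≃*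
      FundamentalGroup Circle (φ (fibreBase (⇑hopf) x₀)) :=
    (homotopyGroupCongrMulEquiv (X := Circle) (x := φ (fibreBase (⇑hopf) x₀)) eIdx).trans
      HomotopyGroup.pi1MulEquivFundamentalGroup
  let e3 : FundamentalGroup Circle (φ (fibreBase (⇑hopf) x₀)) ≃* Multiplicative ℤ :=
    Literature.AlgebraicTopology.FundamentalGroup.fundamentalGroupCircleEquiv _
  exact ⟨eb.trans (eδ.trans (e1.trans (e2.trans e3)))⟩

end HopfFibration

end Literature.AlgebraicTopology.Homotopy

end
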